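import Summits.AnomalousDissipation.AnomalousDissipation.Theorems.WazewskiBlockSubLaminarObliqueChains
import Literature.Analysis.Matrix.TridiagonalDeterminant

/-!
# Route `WazewskiBlock`, item stmt-AnomalousDissipation-10354 — `det (linMatrix ν F N) < 0` for `N ≥ 5` under the crossing criterion

Every block is a tridiagonal chain with positive determinant except the in-plane `k₀ = 1` chain,
whose determinant is negative (continuant comparison at the centre). All statements proved.
-/

noncomputable section

set_option linter.dupNamespace false

open scoped InnerProductSpace ComplexConjugate
open Finset
open Literature.Analysis.FunctionSpaces Literature.Analysis.FunctionSpaces.Torus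
open Literature.Analysis.FluidPDE Literature.Analysis.FluidPDE.Torus

namespace Summit.AnomalousDissipation.AnomalousDissipation.Theorems.Oblique

/-! ### Identifying a block with a chain matrix -/

/-- A bijective parametrisation of a label class computes the square block's determinant. [folklore] -/
theorem det_toSquareBlock_eq_of_param {N n a : ℕ} (M : Matrix (ObliqueIndex N) (ObliqueIndex N) ℝ)
    (g : Fin n → ObliqueIndex N) (hinj : Function.Injective g) (hlab : ∀ i, blockLabel N (g i) = a)
    (hsurj : ∀ p, blockLabel N p = a → ∃ i, g i = p) :
    (M.toSquareBlock (blockLabel N) a).det = (Matrix.of fun i i' => M (g i) (g i')).det := by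
  let e : Fin n ≃ {p // blockLabel N p = a} := Equiv.ofBijective (fun i => ⟨g i, hlab i⟩)
    ⟨fun i i' h => hinj (congrArg Subtype.val h), fun p => by
      obtain ⟨i, hi⟩ := hsurj p.1 p.2
      exact ⟨i, Subtype.ext hi⟩⟩
  rw [← Matrix.det_reindex_self e.symm (M.toSquareBlock (blockLabel N) a)]
  congr 1

/-! ### Generic chains `i ↦ (j, 2T - 2i, j)` -/

section chain

variable {N n : ℕ} {g : Fin n → ObliqueIndex N} {j : ℤ} {T : ℕ}

/-- The `k₁`-coordinate determines the chain index. [folklore] -/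
theorem chain_injective (h1 : ∀ i, ((g i).1 : Fin 3 → ℤ) 1 = 2 * (T : ℤ) - 2 * (i : ℤ)) :
    Function.Injective g := by
  intro i i' h
  have := h1 i
  rw [h, h1 i'] at this
  exact Fin.ext (by omega)

/-- Consecutive chain modes differ by `e`. [folklore] -/
theorem chain_fst_eq_add_modeE (h0 : ∀ i, ((g i).1 : Fin 3 → ℤ) 0 = j)
    (h1 : ∀ i, ((g i).1 : Fin 3 → ℤ) 1 = 2 * (T : ℤ) - 2 * (i : ℤ)) {i i' : Fin n} (h : (i' : ℕ) = i + 1) :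
    ((g i).1 : Fin 3 → ℤ) = ((g i').1 : Fin 3 → ℤ) + modeE := by
  have h2i := (mem_obliqueModes.1 (obliqueReps_subset N (g i).1.2)).2.2.1
  have h2i' := (mem_obliqueModes.1 (obliqueReps_subset N (g i').1.2)).2.2.1
  funext l
  fin_cases l
  · simp [modeE_apply_zero, h0]
  · simp only [Fin.mk_one, Fin.isValue, Pi.add_apply, modeE_apply_one, h1, h]
    push_cast
    ring
  · simp only [Fin.reduceFinMk, Pi.add_apply, modeE_apply_two, add_zero, Fin.isValue]
    rw [← h2i, ← h2i', h0, h0]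

/-- Chain entries vanish beyond the first off-diagonals. [folklore] -/
theorem chain_tri (ν F : ℝ) (h0 : ∀ i, ((g i).1 : Fin 3 → ℤ) 0 = j)
    (h1 : ∀ i, ((g i).1 : Fin 3 → ℤ) 1 = 2 * (T : ℤ) - 2 * (i : ℤ)) (i i' : Fin n)
    (h : (i : ℕ) + 1 < i' ∨ (i' : ℕ) + 1 < i) : linMatrix ν F N (g i) (g i') = 0 := by
  have hi := (g i).1.2
  have hi' := (g i').1.2
  have h00 : ((g i).1 : Fin 3 → ℤ) 0 = ((g i').1 : Fin 3 → ℤ) 0 := by rw [h0, h0]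
  have hm : ((g i).1 : Fin 3 → ℤ) - modeE = ((g i).1 : Fin 3 → ℤ) + (-1 : ℤ) • modeE := by
    simp [sub_eq_add_neg]
  have hp : ((g i).1 : Fin 3 → ℤ) + modeE = ((g i).1 : Fin 3 → ℤ) + (1 : ℤ) • modeE := by simp
  refine linMatrix_eq_zero_of_ne ν F (g i) (g i') ?_ ?_ ?_ ?_ ?_
  · intro hgg
    have := h1 i
    rw [hgg, h1 i'] at this
    omega
  · intro h'
    have := congrFun h' 1
    simp only [Pi.sub_apply, modeE_apply_one, h1] at this
    omega
  · rw [hm]; exact add_smul_modeE_ne_neg hi hi' h00 (-1) (Or.inr rfl)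
  · intro h'
    have := congrFun h' 1
    simp only [Pi.add_apply, modeE_apply_one, h1] at this
    omega
  · rw [hp]; exact add_smul_modeE_ne_neg hi hi' h00 1 (Or.inl rfl)

/-- Diagonal entries are positive (`ν > 0`). [folklore] -/
theorem linMatrix_diag_pos {ν : ℝ} (hν : 0 < ν) (F : ℝ) (p : ObliqueIndex N) : 0 < linMatrix ν F N p p := by
  rw [linMatrix_diag]
  have := freqNormSq_pos_of_mem (obliqueReps_subset N p.1.2)
  positivity

/-- Norms along a chain. [folklore] -/
theorem chain_freqNormSq (h0 : ∀ i, ((g i).1 : Fin 3 → ℤ) 0 = j)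
    (h1 : ∀ i, ((g i).1 : Fin 3 → ℤ) 1 = 2 * (T : ℤ) - 2 * (i : ℤ)) (i : Fin n) :
    freqNormSq ((g i).1 : Fin 3 → ℤ) = 2 * (j : ℝ) ^ 2 + (2 * (T : ℝ) - 2 * ((i : ℕ) : ℝ)) ^ 2 := by
  rw [freqNormSq_eq_of_mem (obliqueReps_subset N (g i).1.2), h0, h1]
  push_cast
  ring

/-- **Perpendicular links**: `-(πA j)²`. [folklore] -/
theorem chain_link_perp (ν F : ℝ) (h0 : ∀ i, ((g i).1 : Fin 3 → ℤ) 0 = j)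
    (h1 : ∀ i, ((g i).1 : Fin 3 → ℤ) 1 = 2 * (T : ℤ) - 2 * (i : ℤ)) (hσ : ∀ i, (g i).2 = 1)
    {i i' : Fin n} (h : (i' : ℕ) = i + 1) :
    linMatrix ν F N (g i) (g i') * linMatrix ν F N (g i') (g i) =
      -((Real.pi * (F / (16 * Real.pi ^ 2 * ν)) * (j : ℝ)) ^ 2) := by
  rw [mul_comm, linMatrix_perp_link ν F (g i') (g i) (hσ i') (hσ i) (by rw [h0, h0])
    (chain_fst_eq_add_modeE h0 h1 h), h0]

/-- **In-plane links**: `-(πA j)² (|k|² - 4)(|k'|² - 4) / (|k'|² |k|²)`. [folklore] -/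
theorem chain_link_inplane (ν F : ℝ) (h0 : ∀ i, ((g i).1 : Fin 3 → ℤ) 0 = j)
    (h1 : ∀ i, ((g i).1 : Fin 3 → ℤ) 1 = 2 * (T : ℤ) - 2 * (i : ℤ)) (hσ : ∀ i, (g i).2 = 0)
    {i i' : Fin n} (h : (i' : ℕ) = i + 1) :
    linMatrix ν F N (g i) (g i') * linMatrix ν F N (g i') (g i) =
      -((Real.pi * (F / (16 * Real.pi ^ 2 * ν)) * (j : ℝ)) ^ 2) *
        ((freqNormSq ((g i).1 : Fin 3 → ℤ) - 4) * (freqNormSq ((g i').1 : Fin 3 → ℤ) - 4)) /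
          (freqNormSq ((g i').1 : Fin 3 → ℤ) * freqNormSq ((g i).1 : Fin 3 → ℤ)) := by
  rw [mul_comm, linMatrix_inplane_link ν F (g i') (g i) (hσ i') (hσ i) (by rw [h0, h0])
    (chain_fst_eq_add_modeE h0 h1 h), h0]

/-- Integers at distance `≥ 1`. [folklore] -/
theorem one_le_sq_sub_of_ne {a b : ℕ} (h : a ≠ b) : (1 : ℝ) ≤ ((a : ℝ) - (b : ℝ)) ^ 2 := by
  rcases Nat.lt_or_gt_of_ne h with hlt | hlt
  · have : (a : ℝ) + 1 ≤ b := by exact_mod_cast hlt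
    nlinarith
  · have : (b : ℝ) + 1 ≤ a := by exact_mod_cast hlt
    nlinarith

/-- **Positive blocks**: perpendicular chains, and in-plane chains with `j = 0` or `j ≥ 2`
(all links `≤ 0`). [folklore] -/
theorem chain_det_pos {ν : ℝ} (hν : 0 < ν) (F : ℝ) (h0 : ∀ i, ((g i).1 : Fin 3 → ℤ) 0 = j)
    (h1 : ∀ i, ((g i).1 : Fin 3 → ℤ) 1 = 2 * (T : ℤ) - 2 * (i : ℤ)) {σ : Fin 2} (hσ : ∀ i, (g i).2 = σ)
    (hsign : σ = 1 ∨ j = 0 ∨ 2 ≤ j) :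
    0 < (Matrix.of fun i i' => linMatrix ν F N (g i) (g i')).det := by
  refine Literature.Analysis.Matrix.det_tridiagonal_pos _ (fun i i' h => chain_tri ν F h0 h1 i i' h)
    (fun i => linMatrix_diag_pos hν F (g i)) ?_
  intro i i' h
  simp only [Matrix.of_apply]
  obtain rfl | rfl : σ = 0 ∨ σ = 1 := by fin_cases σ <;> simp
  · rw [chain_link_inplane ν F h0 h1 hσ h]
    have hposi := freqNormSq_pos_of_mem (obliqueReps_subset N (g i).1.2)
    have hposi' := freqNormSq_pos_of_mem (obliqueReps_subset N (g i').1.2)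
    rcases hsign with h10 | hj | hj
    · exact absurd h10 (by decide)
    · subst hj
      simp
    · have h4 : ∀ i₀ : Fin n, 4 ≤ freqNormSq ((g i₀).1 : Fin 3 → ℤ) := fun i₀ => by
        rw [chain_freqNormSq h0 h1]
        have : (2 : ℝ) ≤ (j : ℝ) := by exact_mod_cast hj
        nlinarith [sq_nonneg (2 * (T : ℝ) - 2 * ((i₀ : ℕ) : ℝ))]
      have hX : 0 ≤ (freqNormSq ((g i).1 : Fin 3 → ℤ) - 4) * (freqNormSq ((g i').1 : Fin 3 → ℤ) - 4) :=
        mul_nonneg (by linarith [h4 i]) (by linarith [h4 i'])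
      rw [neg_mul, neg_div, neg_nonpos]
      exact div_nonneg (mul_nonneg (sq_nonneg _) hX) (mul_pos hposi' hposi).le
  · rw [chain_link_perp ν F h0 h1 hσ h, neg_nonpos]
    exact sq_nonneg _

/-- **The negative block**: the in-plane `j = 1` chain under the crossing criterion
`t₀ (t₁ + |p₁|/t₂) < p₀` at the centre `k₁ = 0`. [folklore] -/
theorem chain_det_neg {ν : ℝ} (hν : 0 < ν) (F : ℝ) (h0 : ∀ i, ((g i).1 : Fin 3 → ℤ) 0 = ((1 : ℕ) : ℤ))
    (h1 : ∀ i, ((g i).1 : Fin 3 → ℤ) 1 = 2 * (T : ℤ) - 2 * (i : ℤ)) (hσ : ∀ i, (g i).2 = 0)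
    (hn : T + 3 ≤ n)
    (hcrit : 8 * ν * Real.pi ^ 2 * (24 * ν * Real.pi ^ 2 +
        (7 * (Real.pi * (F / (16 * Real.pi ^ 2 * ν))) ^ 2 / 27) / (72 * ν * Real.pi ^ 2)) <
        (Real.pi * (F / (16 * Real.pi ^ 2 * ν))) ^ 2 / 3) :
    (Matrix.of fun i i' => linMatrix ν F N (g i) (g i')).det < 0 := by
  have hnorm : ∀ i : Fin n, freqNormSq ((g i).1 : Fin 3 → ℤ) = 2 + (2 * (T : ℝ) - 2 * ((i : ℕ) : ℝ)) ^ 2 :=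
    fun i => by rw [chain_freqNormSq h0 h1 i]; push_cast; ring
  have hlinkv : ∀ i i' : Fin n, (i' : ℕ) = i + 1 →
      linMatrix ν F N (g i) (g i') * linMatrix ν F N (g i') (g i) =
        -(Real.pi * (F / (16 * Real.pi ^ 2 * ν))) ^ 2 *
          ((((2 * (T : ℝ) - 2 * ((i : ℕ) : ℝ)) ^ 2 - 2) * ((2 * (T : ℝ) - 2 * ((i' : ℕ) : ℝ)) ^ 2 - 2)) /
            ((2 + (2 * (T : ℝ) - 2 * ((i' : ℕ) : ℝ)) ^ 2) * (2 + (2 * (T : ℝ) - 2 * ((i : ℕ) : ℝ)) ^ 2))) := by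
    intro i i' h
    rw [chain_link_inplane ν F h0 h1 hσ h, hnorm, hnorm]
    push_cast
    ring
  have hTn : T < n := by omega
  have hT1n : T + 1 < n := by omega
  have hT2n : T + 2 < n := by omega
  have hd : ∀ (m : ℕ) (hm : m < n), linMatrix ν F N (g ⟨m, hm⟩) (g ⟨m, hm⟩) =
      ν * (4 * Real.pi ^ 2 * (2 + (2 * (T : ℝ) - 2 * (m : ℝ)) ^ 2)) := fun m hm => by
    rw [linMatrix_diag, hnorm]
  have hd0 : linMatrix ν F N (g ⟨T, hTn⟩) (g ⟨T, hTn⟩) = 8 * ν * Real.pi ^ 2 := by rw [hd]; ring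
  have hd1 : linMatrix ν F N (g ⟨T + 1, hT1n⟩) (g ⟨T + 1, hT1n⟩) = 24 * ν * Real.pi ^ 2 := by
    rw [hd]; push_cast; ring
  have hd2 : linMatrix ν F N (g ⟨T + 2, hT2n⟩) (g ⟨T + 2, hT2n⟩) = 72 * ν * Real.pi ^ 2 := by
    rw [hd]; push_cast; ring
  have hl12 : linMatrix ν F N (g ⟨T + 1, hT1n⟩) (g ⟨T + 2, hT2n⟩) * linMatrix ν F N (g ⟨T + 2, hT2n⟩) (g ⟨T + 1, hT1n⟩) =
      -(7 * (Real.pi * (F / (16 * Real.pi ^ 2 * ν))) ^ 2 / 27) := by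
    rw [hlinkv ⟨T + 1, hT1n⟩ ⟨T + 2, hT2n⟩ rfl]
    push_cast
    ring
  have hl01 : linMatrix ν F N (g ⟨T, hTn⟩) (g ⟨T + 1, hT1n⟩) * linMatrix ν F N (g ⟨T + 1, hT1n⟩) (g ⟨T, hTn⟩) =
      (Real.pi * (F / (16 * Real.pi ^ 2 * ν))) ^ 2 / 3 := by
    rw [hlinkv ⟨T, hTn⟩ ⟨T + 1, hT1n⟩ rfl]
    push_cast
    ring
  refine Literature.Analysis.Matrix.det_tridiagonal_neg_of_center T _ hn
    (fun i i' h => chain_tri ν F h0 h1 i i' h) (fun i => linMatrix_diag_pos hν F (g i)) ?_ ?_ ?_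
  · -- links away from the centre are `≤ 0`
    intro i i' h hi1 hi2
    simp only [Matrix.of_apply]
    rw [hlinkv i i' h]
    have hi'T : (i' : ℕ) ≠ T := by omega
    have ha : (2 : ℝ) ≤ (2 * (T : ℝ) - 2 * ((i : ℕ) : ℝ)) ^ 2 - 2 := by
      nlinarith [one_le_sq_sub_of_ne (Ne.symm hi2)]
    have hb : (2 : ℝ) ≤ (2 * (T : ℝ) - 2 * ((i' : ℕ) : ℝ)) ^ 2 - 2 := by
      nlinarith [one_le_sq_sub_of_ne (Ne.symm hi'T)]
    rw [neg_mul, neg_nonpos]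
    exact mul_nonneg (sq_nonneg _) (div_nonneg (mul_nonneg (by linarith) (by linarith)) (by positivity))
  · -- the link entering the centre is `≥ 0`
    intro i i' h hi1
    simp only [Matrix.of_apply]
    rw [hlinkv i i' h]
    have hT : (T : ℝ) = ((i : ℕ) : ℝ) + 1 := by exact_mod_cast hi1.symm
    have hi' : ((i' : ℕ) : ℝ) = ((i : ℕ) : ℝ) + 1 := by exact_mod_cast h
    rw [hT, hi']
    have : -(Real.pi * (F / (16 * Real.pi ^ 2 * ν))) ^ 2 *
        (((2 * (((i : ℕ) : ℝ) + 1) - 2 * ((i : ℕ) : ℝ)) ^ 2 - 2) *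
            ((2 * (((i : ℕ) : ℝ) + 1) - 2 * (((i : ℕ) : ℝ) + 1)) ^ 2 - 2) /
          ((2 + (2 * (((i : ℕ) : ℝ) + 1) - 2 * (((i : ℕ) : ℝ) + 1)) ^ 2) *
            (2 + (2 * (((i : ℕ) : ℝ) + 1) - 2 * ((i : ℕ) : ℝ)) ^ 2))) =
        (Real.pi * (F / (16 * Real.pi ^ 2 * ν))) ^ 2 / 3 := by ring
    rw [this]
    positivity
  · simp only [Matrix.of_apply]
    rw [hd0, hd1, hd2, hl12, hl01, abs_neg, abs_of_nonneg (by positivity)]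
    exact hcrit

end chain

/-! ### The determinant is negative -/

/-- `2 k₀² ≤ N²` for representatives, in `ℕ`. [folklore] -/
theorem two_mul_toNat_sq_le {N : ℕ} {k : Fin 3 → ℤ} (hk : k ∈ obliqueReps N) :
    2 * (k 0).toNat ^ 2 ≤ N ^ 2 := by
  have hkm := obliqueReps_subset N hk
  have hb := mem_freqBall.1 (obliqueModes_subset N hkm)
  rw [freqNormSq_eq_of_mem hkm] at hb
  have h0 : 0 ≤ k 0 := by
    rcases (mem_obliqueReps.1 hk).2 with h | h
    · exact h.le
    · exact h.1.ge
  have hk0 : (((k 0).toNat : ℤ) : ℝ) = ((k 0 : ℤ) : ℝ) := by exact_mod_cast Int.toNat_of_nonneg h0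
  have : (2 : ℝ) * ((k 0).toNat : ℝ) ^ 2 ≤ (N : ℝ) ^ 2 := by
    have e : ((k 0).toNat : ℝ) = ((k 0 : ℤ) : ℝ) := by rw [← hk0]; norm_cast
    rw [e]
    nlinarith [sq_nonneg ((k 1 : ℤ) : ℝ)]
  exact_mod_cast this

/-- Surjectivity of a chain parametrisation onto its label class. [folklore] -/
theorem chain_param_surj {N n : ℕ} {g : Fin n → ObliqueIndex N} {σ : Fin 2} {j : ℤ}
    (hσ : ∀ i, (g i).2 = σ) (h0 : ∀ i, ((g i).1 : Fin 3 → ℤ) 0 = j)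
    (hcover : ∀ k : Fin 3 → ℤ, k ∈ obliqueReps N → k 0 = j → ∃ i, ((g i).1 : Fin 3 → ℤ) = k)
    (i₀ : Fin n) (p : ObliqueIndex N) (hp : blockLabel N p = blockLabel N (g i₀)) : ∃ i, g i = p := by
  obtain ⟨h2, h00⟩ := (blockLabel_eq_iff p (g i₀)).1 hp
  obtain ⟨i, hi⟩ := hcover (p.1 : Fin 3 → ℤ) p.1.2 (by rw [h00, h0])
  exact ⟨i, Prod.ext (Subtype.ext hi) ((hσ i).trans ((hσ i₀).symm.trans h2.symm))⟩

/-- Labels are constant along a chain parametrisation. [folklore] -/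
theorem chain_param_label {N n : ℕ} {g : Fin n → ObliqueIndex N} {σ : Fin 2} {j : ℤ}
    (hσ : ∀ i, (g i).2 = σ) (h0 : ∀ i, ((g i).1 : Fin 3 → ℤ) 0 = j) (i₀ i : Fin n) :
    blockLabel N (g i) = blockLabel N (g i₀) :=
  (blockLabel_eq_iff (g i) (g i₀)).2 ⟨by rw [hσ, hσ], by rw [h0, h0]⟩

/-- **`det (linMatrix ν F N) < 0`** for `N ≥ 5`, `ν > 0`, under the crossing criterion: in the
block-diagonal structure (labels `blockLabel`) every block is a tridiagonal chain with positive
determinant, except the in-plane `k₀ = 1` chain, whose determinant is negative. [folklore] -/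
theorem det_linMatrix_neg {N : ℕ} (hN : 5 ≤ N) {ν : ℝ} (hν : 0 < ν) (F : ℝ)
    (hcrit : 8 * ν * Real.pi ^ 2 * (24 * ν * Real.pi ^ 2 +
        (7 * (Real.pi * (F / (16 * Real.pi ^ 2 * ν))) ^ 2 / 27) / (72 * ν * Real.pi ^ 2)) <
        (Real.pi * (F / (16 * Real.pi ^ 2 * ν))) ^ 2 / 3) :
    (linMatrix ν F N).det < 0 := by
  rw [(blockTriangular_linMatrix ν F N).det]
  -- the exceptional chain: in-plane, `k₀ = 1`
  obtain ⟨T₁, hT₁⟩ := exists_chain_halfLength N 1 (by nlinarith)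
  have hT₁2 : 2 ≤ T₁ := (hT₁ 2).1 (by nlinarith)
  set g₁ : Fin (2 * T₁ + 1) → ObliqueIndex N := fun i =>
    (⟨![((1 : ℕ) : ℤ), 2 * (T₁ : ℤ) - 2 * (i : ℤ), ((1 : ℕ) : ℤ)], chainMode_mem le_rfl hT₁ i⟩, 0) with hg₁
  have hσ₁ : ∀ i, (g₁ i).2 = 0 := fun i => rfl
  have h0₁ : ∀ i, ((g₁ i).1 : Fin 3 → ℤ) 0 = ((1 : ℕ) : ℤ) := fun i => by simp [hg₁]
  have h1₁ : ∀ i, ((g₁ i).1 : Fin 3 → ℤ) 1 = 2 * (T₁ : ℤ) - 2 * (i : ℤ) := fun i => by simp [hg₁]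
  have i₁ : Fin (2 * T₁ + 1) := ⟨0, by omega⟩
  have hmem : blockLabel N (g₁ i₁) ∈ Finset.univ.image (blockLabel N) :=
    Finset.mem_image_of_mem _ (Finset.mem_univ _)
  rw [← Finset.mul_prod_erase _ _ hmem]
  refine mul_neg_of_neg_of_pos ?_ (Finset.prod_pos fun a ha => ?_)
  · rw [det_toSquareBlock_eq_of_param _ g₁ (chain_injective h1₁) (chain_param_label hσ₁ h0₁ i₁)
      (chain_param_surj hσ₁ h0₁ (fun k hk hk0 => by
        obtain ⟨i, rfl⟩ := exists_eq_chainMode hT₁ hk hk0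
        exact ⟨i, by simp [hg₁]⟩) i₁)]
    exact chain_det_neg hν F h0₁ h1₁ hσ₁ (by omega) hcrit
  · obtain ⟨hne, ha'⟩ := Finset.mem_erase.1 ha
    obtain ⟨p, -, rfl⟩ := Finset.mem_image.1 ha'
    obtain ⟨⟨k, hk⟩, σ⟩ := p
    have hk0 : 0 ≤ k 0 := by
      rcases (mem_obliqueReps.1 hk).2 with h | h
      · exact h.le
      · exact h.1.ge
    by_cases hz : k 0 = 0
    · -- the gravest chain `k₀ = 0`
      set gA : Fin (N / 2) → ObliqueIndex N := fun i =>
        (⟨![(0 : ℤ), 2 * ((N / 2 : ℕ) : ℤ) - 2 * (i : ℤ), 0], axisMode_mem i⟩, σ) with hgA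
      have hσA : ∀ i, (gA i).2 = σ := fun i => rfl
      have h0A : ∀ i, ((gA i).1 : Fin 3 → ℤ) 0 = (0 : ℤ) := fun i => by simp [hgA]
      have h1A : ∀ i, ((gA i).1 : Fin 3 → ℤ) 1 = 2 * ((N / 2 : ℕ) : ℤ) - 2 * (i : ℤ) := fun i => by simp [hgA]
      obtain ⟨i₀, hi₀⟩ := exists_eq_axisMode hk hz
      have hp : (⟨⟨k, hk⟩, σ⟩ : ObliqueIndex N) = gA i₀ := Prod.ext (Subtype.ext (by simpa [hgA] using hi₀)) rfl
      rw [hp, det_toSquareBlock_eq_of_param _ gA (chain_injective h1A) (chain_param_label hσA h0A i₀)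
        (chain_param_surj hσA h0A (fun k' hk' hk'0 => by
          obtain ⟨i, rfl⟩ := exists_eq_axisMode hk' hk'0
          exact ⟨i, by simp [hgA]⟩) i₀)]
      exact chain_det_pos hν F h0A h1A hσA (Or.inr (Or.inl rfl))
    · -- a chain with `k₀ = j ≥ 1`
      set j : ℕ := (k 0).toNat with hj
      have hjk : ((j : ℕ) : ℤ) = k 0 := Int.toNat_of_nonneg hk0
      have hj1 : 1 ≤ j := by omega
      obtain ⟨T, hT⟩ := exists_chain_halfLength N j (two_mul_toNat_sq_le hk)
      set gC : Fin (2 * T + 1) → ObliqueIndex N := fun i =>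
        (⟨![((j : ℕ) : ℤ), 2 * (T : ℤ) - 2 * (i : ℤ), ((j : ℕ) : ℤ)], chainMode_mem hj1 hT i⟩, σ) with hgC
      have hσC : ∀ i, (gC i).2 = σ := fun i => rfl
      have h0C : ∀ i, ((gC i).1 : Fin 3 → ℤ) 0 = ((j : ℕ) : ℤ) := fun i => by simp [hgC]
      have h1C : ∀ i, ((gC i).1 : Fin 3 → ℤ) 1 = 2 * (T : ℤ) - 2 * (i : ℤ) := fun i => by simp [hgC]
      obtain ⟨i₀, hi₀⟩ := exists_eq_chainMode hT hk hjk.symm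
      have hp : (⟨⟨k, hk⟩, σ⟩ : ObliqueIndex N) = gC i₀ := Prod.ext (Subtype.ext (by simpa [hgC] using hi₀)) rfl
      have hsign : σ = 1 ∨ ((j : ℕ) : ℤ) = 0 ∨ 2 ≤ ((j : ℕ) : ℤ) := by
        obtain rfl | rfl : σ = 0 ∨ σ = 1 := by fin_cases σ <;> simp
        · -- in-plane: `j ≠ 1`, for `j = 1` is the exceptional label
          refine Or.inr (Or.inr ?_)
          have hj1' : j ≠ 1 := by
            intro hje
            apply hne
            exact (blockLabel_eq_iff _ _).2 ⟨rfl, by rw [h0₁]; simp [← hjk, hje]⟩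
          omega
        · exact Or.inl rfl
      rw [hp, det_toSquareBlock_eq_of_param _ gC (chain_injective h1C) (chain_param_label hσC h0C i₀)
        (chain_param_surj hσC h0C (fun k' hk' hk'0 => by
          obtain ⟨i, rfl⟩ := exists_eq_chainMode hT hk' hk'0
          exact ⟨i, by simp [hgC]⟩) i₀)]
      exact chain_det_pos hν F h0C h1C hσC hsign

end Summit.AnomalousDissipation.AnomalousDissipation.Theorems.Oblique

end
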